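import Literature.InformationTheory.QuantumCodes.ExtremalTypeIWeightEnumerators
import Literature.InformationTheory.QuantumCodes.AdditiveCodeEquivalence
import HarnessLib

/-!
# Shortening an extremal self-dual additive code at a coordinate: the minimum-weight words of `[[6m+6, 0, 2m+4]]`
codes meet every (coordinate, nonzero letter) equally often

[cite: CalderbankEtAl1998, §4 Thm. 6 (d) (printed p. 13)] Calderbank–Rains–Shor–Sloane 1998: from an `[[n, 0, d]]`
code `C`, «let `B = {u : 0u or 1u ∈ C}` … the words in `B⊥ ∖ B` arise from truncation … so the minimal distance in
general is reduced by 1» — the `[[n−1, 0, d−1]]` shortening at a coordinate with respect to a nonzero letter.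
[cite: BautistaEtAl2007, Thm. 2.5, Rem. 2.7] (the weight enumerator of an extremal `[[6m+5, 0, 2m+3]]` is uniquely
determined: `wtDist_5_0_3`, `wtDist_11_0_5`, `wtDist_17_0_7`, `wtDist_23_0_9`, `wtDist_29_0_11`).

## What is typed (consequences drawn here in the kernel from BGKW07 Rem. 2.7 + CRSS98 Thm. 6 (d); no printed statement of the
regularity located by the filer — qec-lead g9 RULING 227c (a): kernel corollary in Literature, no ‹ours› word pending an
independent presearch and referee look)

* `sympWeight_eq_puncture_add` — exact weight bookkeeping under puncturing.
* `exists_shortening_count` — CRSS Thm. 6 (d) for a self-dual code at the last coordinate and the letter `Y = (1,1)`,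
  WITH THE COUNT: the shortened `[[m, 0, d]]` code `B = ρ(C ∩ y⊥)` has exactly as many words of weight `d` as `C`
  has words of weight `d+1` whose last letter is `Y`.
* `card_minWeight_letter_eq` — transport by the equivalence group `𝒢ₙ` (`monomial`, `AdditiveCodeEquivalence.lean`):
  if every `[[m, 0, d]]` code has exactly `N` words of weight `d`, then in every `[[m+1, 0, d+1]]` code every
  coordinate `q` and nonzero letter `p` lie on exactly `N` minimum-weight words.
* Instances: `card_minWeight_letter_6_0_4` (hexacode: `10`), `card_minWeight_letter_12_0_6` (dodecacode and any
  `(12, 2¹², 6)`: `66`), `card_minWeight_letter_18_0_8` (`408`), `card_minWeight_letter_30_0_12` (`15834`), and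
  ★ `card_minWeight_letter_24_0_10`: in a putative `(24, 2²⁴, 10)` code (HP03 Research Problem 9.10.7) every
  coordinate/letter pair lies on exactly `2530` words of weight `10` (so each coordinate on `7590 = 18216·10/24`).

No new definitions; theorems only.
-/

noncomputable section

open Finset

open scoped Classical Pointwise

namespace Literature.InformationTheory.QuantumCodes

variable {m : ℕ}

/-- Exact weight bookkeeping under puncturing: `wt v = wt ρ(v) + [letter_last(v) ≠ 0]`.
[cite: CalderbankEtAl1998, §4 Thm. 6 proof of (d) (printed p. 13)] -/
theorem sympWeight_eq_puncture_add (v : SympVec (m + 1)) :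
    sympWeight v = sympWeight (puncture m v) +
      (if v.1 (Fin.last m) ≠ 0 ∨ v.2 (Fin.last m) ≠ 0 then 1 else 0) := by
  unfold sympWeight
  rw [Finset.card_filter, Finset.card_filter, Fin.sum_univ_castSucc]
  congr 1

/-- A letter permutation (`LocalDatum`) acts injectively on letters. [cite: CalderbankEtAl1998, §3 (printed p. 11)] -/
theorem LocalDatum.act_injective (D : LocalDatum) : Function.Injective D.act := by
  intro a b h
  have h1 : letterForm a (1, 0) = letterForm b (1, 0) := by
    rw [← D.letterForm_act a (1, 0), ← D.letterForm_act b (1, 0), h]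
  have h2 : letterForm a (0, 1) = letterForm b (0, 1) := by
    rw [← D.letterForm_act a (0, 1), ← D.letterForm_act b (0, 1), h]
  simp only [letterForm, mul_zero, zero_add, one_mul, mul_one, zero_mul, add_zero] at h1 h2
  exact Prod.ext h2 h1

/-- **CRSS Thm. 6 (d) with the count, at the last coordinate.** For a self-dual `[[m+1, 0, d+1]]` code `C` (`d ≥ 1`),
`B = ρ(C ∩ y⊥)`, `y = (e_ℓ | e_ℓ)` («`B = {u : 0u or 1u ∈ C}`») is an `[[m, 0, d]]` code, and its words of weight `d`
correspond bijectively (by puncturing) to the words of `C` of weight `d+1` with last letter `Y = (1,1)`.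
[cite: CalderbankEtAl1998, §4 Thm. 6 (d) (printed p. 13)] -/
theorem exists_shortening_count {d : ℕ} {S : Submodule (ZMod 2) (SympVec (m + 1))}
    (hC : IsAdditiveCode S 0 (d + 1)) (hd : 1 ≤ d) :
    ∃ B : Submodule (ZMod 2) (SympVec m), IsAdditiveCode B 0 d ∧
      wtDist B d = #{v ∈ codeWords S | sympWeight v = d + 1 ∧ v.1 (Fin.last m) = 1 ∧ v.2 (Fin.last m) = 1} := by
  obtain ⟨hso, hdim, _, hconv⟩ := hC
  have hconv' : ∀ v ∈ S, v ≠ 0 → d + 1 ≤ sympWeight v := hconv rfl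
  have hdimS : Module.finrank (ZMod 2) S = m + 1 := by omega
  have hSD : sympDual S = S := sympDual_eq_self_iff.2 ⟨hso, hdimS⟩
  set y := lastY m with hy
  let H : Submodule (ZMod 2) (SympVec (m + 1)) := LinearMap.ker (sympForm (m + 1) y)
  have hmemH : ∀ v, v ∈ H ↔ sympInner y v = 0 := fun v => LinearMap.mem_ker
  have h01 : ∀ c : ZMod 2, c ≠ 0 → c = 1 := by decide
  have hyS : y ∉ S := fun hyS => by
    have hy0 : y ≠ 0 := fun h0 => by
      have := sympWeight_lastY m
      rw [← hy, h0, (sympWeight_eq_zero_iff _).2 rfl] at this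
      exact zero_ne_one this
    have := hconv' y hyS hy0
    rw [hy, sympWeight_lastY] at this
    omega
  let T : Submodule (ZMod 2) (SympVec (m + 1)) := S ⊓ H
  let B : Submodule (ZMod 2) (SympVec m) := T.map (puncture m)
  -- `ρ` is injective on `T`
  have hinj0 : ∀ v ∈ T, puncture m v = 0 → v = 0 := by
    intro v hv hρ
    have heq := eq_smul_lastY v ((hmemH v).1 (Submodule.mem_inf.1 hv).2) hρ
    by_cases hc : v.1 (Fin.last m) = 0
    · rw [hc, zero_smul] at heq; exact heq
    · exfalso
      rw [h01 _ hc, one_smul] at heq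
      exact hyS (by rw [hy, ← heq]; exact (Submodule.mem_inf.1 hv).1)
  -- `dim T + 1 = dim S̄` (rank–nullity for `(y, ·)` on `S̄`; `y ∉ S̄ = S̄⊥`)
  obtain ⟨s₀, hs₀, hs₀y⟩ : ∃ s₀ ∈ S, sympInner y s₀ ≠ 0 := by
    by_contra hall
    push Not at hall
    exact hyS (by rw [← hSD]; exact mem_sympDual_iff.2 fun s hs => by rw [sympInner_comm]; exact hall s hs)
  have hT1 : Module.finrank (ZMod 2) T + 1 = Module.finrank (ZMod 2) S := by
    let φ : S →ₗ[ZMod 2] ZMod 2 := (sympForm (m + 1) y).domRestrict S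
    have hrange : LinearMap.range φ = ⊤ := by
      rw [eq_top_iff]
      rintro t -
      refine ⟨t • (sympInner y s₀)⁻¹ • ⟨s₀, hs₀⟩, ?_⟩
      simp only [map_smul, φ, LinearMap.domRestrict_apply, sympForm_apply, smul_eq_mul]
      rw [inv_mul_cancel₀ hs₀y, mul_one]
    have hkerT : Module.finrank (ZMod 2) (LinearMap.ker φ) = Module.finrank (ZMod 2) T := by
      have hk : LinearMap.ker φ = T.comap S.subtype := by
        ext ⟨v, hv⟩
        simp only [LinearMap.mem_ker, φ, LinearMap.domRestrict_apply, Submodule.mem_comap,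
          Submodule.subtype_apply, T, Submodule.mem_inf, hv, true_and]
        exact (hmemH v).symm
      rw [hk]
      exact LinearEquiv.finrank_eq (Submodule.comapSubtypeEquivOfLe (inf_le_left : T ≤ S))
    have hrn := LinearMap.finrank_range_add_finrank_ker φ
    rw [hrange, finrank_top, Module.finrank_self, hkerT] at hrn
    omega
  have hinj : Function.Injective ((puncture m).domRestrict T) := by
    intro a b hab
    apply Subtype.ext
    have hmem : (a : SympVec (m + 1)) - b ∈ T := T.sub_mem a.2 b.2
    have h0 : puncture m ((a : SympVec (m + 1)) - b) = 0 := by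
      rw [map_sub, sub_eq_zero]; simpa [LinearMap.domRestrict_apply] using hab
    exact sub_eq_zero.1 (hinj0 _ hmem h0)
  have hfinB : Module.finrank (ZMod 2) B = m := by
    have hrB : Module.finrank (ZMod 2) B = Module.finrank (ZMod 2) T := by
      change Module.finrank (ZMod 2) ↥(T.map (puncture m)) = _
      rw [← LinearMap.range_domRestrict, LinearMap.finrank_range_of_inj hinj]
    omega
  -- self-orthogonality and self-duality of `B`
  have hBso : IsSelfOrthogonal B := by
    intro u hu
    rw [mem_sympDual_iff]
    intro u' hu'
    obtain ⟨v, hv, rfl⟩ := Submodule.mem_map.1 hu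
    obtain ⟨v', hv', rfl⟩ := Submodule.mem_map.1 hu'
    rw [sympInner_puncture_of_orth ((hmemH _).1 (Submodule.mem_inf.1 hv').2)
      ((hmemH _).1 (Submodule.mem_inf.1 hv).2)]
    exact mem_sympDual_iff.1 (hso (Submodule.mem_inf.1 hv).1) _ (Submodule.mem_inf.1 hv').1
  have hBSD : sympDual B = B := sympDual_eq_self_iff.2 ⟨hBso, hfinB⟩
  -- weights in `B`
  have hBwt : ∀ u ∈ B, u ≠ 0 → d ≤ sympWeight u := by
    intro u hu hu0
    obtain ⟨v, hv, rfl⟩ := Submodule.mem_map.1 hu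
    have hv0 : v ≠ 0 := by rintro rfl; exact hu0 (map_zero _)
    have h1 := hconv' v (Submodule.mem_inf.1 hv).1 hv0
    have h2 := sympWeight_le_puncture_succ v
    omega
  refine ⟨B, ⟨hBso, by omega, fun w hw hwB => absurd (by rwa [hBSD] at hw) hwB, fun _ => hBwt⟩, ?_⟩
  -- the count: `{u ∈ B : wt u = d}` ≃ `{v ∈ S : wt v = d+1, letter_ℓ v = Y}` by `v ↦ ρ v`
  rw [wtDist]
  symm
  refine Finset.card_bij (fun v _ => puncture m v) (fun v hv => ?_) (fun v hv v' hv' h => ?_) (fun u hu => ?_)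
  · rw [Finset.mem_filter, mem_codeWords] at hv ⊢
    obtain ⟨hvS, hwt, h1, h2⟩ := hv
    have hvH : v ∈ H := (hmemH v).2 (by rw [sympInner_lastY_left, h1, h2]; decide)
    refine ⟨Submodule.mem_map_of_mem (Submodule.mem_inf.2 ⟨hvS, hvH⟩), ?_⟩
    have := sympWeight_eq_puncture_add v
    rw [h1, if_pos (Or.inl one_ne_zero)] at this
    omega
  · rw [Finset.mem_filter, mem_codeWords] at hv hv'
    have hvT : v ∈ T := Submodule.mem_inf.2 ⟨hv.1, (hmemH v).2 (by rw [sympInner_lastY_left, hv.2.2.1, hv.2.2.2]; decide)⟩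
    have hv'T : v' ∈ T := Submodule.mem_inf.2 ⟨hv'.1, (hmemH v').2 (by rw [sympInner_lastY_left, hv'.2.2.1, hv'.2.2.2]; decide)⟩
    have := hinj (a₁ := ⟨v, hvT⟩) (a₂ := ⟨v', hv'T⟩) (by simpa [LinearMap.domRestrict_apply] using h)
    exact congrArg Subtype.val this
  · rw [Finset.mem_filter, mem_codeWords] at hu
    obtain ⟨huB, hwt⟩ := hu
    obtain ⟨v, hv, rfl⟩ := Submodule.mem_map.1 huB
    have hvS := (Submodule.mem_inf.1 hv).1
    have hvH := (hmemH v).1 (Submodule.mem_inf.1 hv).2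
    have hv0 : v ≠ 0 := by
      rintro rfl
      rw [map_zero, (sympWeight_eq_zero_iff _).2 rfl] at hwt
      omega
    have hge := hconv' v hvS hv0
    have hex := sympWeight_eq_puncture_add v
    rw [sympInner_lastY_left] at hvH
    -- the last letter is nonzero (else `wt v = d`), hence `Y` (as `v ∈ H`)
    have hlast : v.1 (Fin.last m) = 1 ∧ v.2 (Fin.last m) = 1 := by
      by_cases hz : v.1 (Fin.last m) ≠ 0 ∨ v.2 (Fin.last m) ≠ 0
      · have key : ∀ a b : ZMod 2, b + a = 0 → (a ≠ 0 ∨ b ≠ 0) → a = 1 ∧ b = 1 := by decide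
        exact key _ _ hvH hz
      · rw [if_neg hz] at hex
        omega
    refine ⟨v, ?_, rfl⟩
    rw [Finset.mem_filter, mem_codeWords]
    refine ⟨hvS, ?_, hlast.1, hlast.2⟩
    rw [if_pos (Or.inl (by rw [hlast.1]; exact one_ne_zero))] at hex
    omega

/-- **Transport by the equivalence group.** If every `[[m, 0, d]]` code has exactly `N` words of weight `d`, then in
every `[[m+1, 0, d+1]]` code every coordinate `q` and nonzero letter `p` lie on exactly `N` words of weight `d+1`
(move `q` to the last coordinate and `p` to `Y` by a monomial map of `𝒢ₙ`, then shorten). Consequence drawn here from BGKW07 Rem. 2.7 + CRSS98 Thm. 6 (d); no printed statement located by the filer.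
[cite: CalderbankEtAl1998, §3 (printed p. 11: `𝒢ₙ` preserves weights) and §4 Thm. 6 (d)] -/
theorem card_minWeight_letter_eq {d N : ℕ} (hd : 1 ≤ d)
    (hN : ∀ B : Submodule (ZMod 2) (SympVec m), IsAdditiveCode B 0 d → wtDist B d = N)
    {S : Submodule (ZMod 2) (SympVec (m + 1))} (hC : IsAdditiveCode S 0 (d + 1)) (q : Fin (m + 1))
    {p : ZMod 2 × ZMod 2} (hp : p ≠ 0) :
    #{v ∈ codeWords S | sympWeight v = d + 1 ∧ letterAt v q = p} = N := by
  -- a letter permutation taking `p` to `Y = (1,1)`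
  obtain ⟨D, hD⟩ : ∃ D : LocalDatum, D.act p = (1, 1) := by
    have hcases : p = (1, 0) ∨ p = (0, 1) ∨ p = (1, 1) := by
      revert hp; revert p; decide
    rcases hcases with rfl | rfl | rfl
    · exact ⟨⟨((1, 1), (0, 1)), by decide⟩, by decide⟩
    · exact ⟨⟨((1, 0), (1, 1)), by decide⟩, by decide⟩
    · exact ⟨LocalDatum.idDatum, by decide⟩
  set σ : Equiv.Perm (Fin (m + 1)) := Equiv.swap q (Fin.last m) with hσ
  set g : codeEquivGroup (m + 1) := ⟨monomial σ (fun _ => D), monomial_mem_codeEquivGroup σ _⟩ with hg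
  have hgv : ∀ v, (g : SympVec (m + 1) ≃ₗ[ZMod 2] SympVec (m + 1)) v = monomial σ (fun _ => D) v := fun v => rfl
  have hwt : ∀ v, sympWeight (monomial σ (fun _ => D) v) = sympWeight v :=
    fun v => (monomial_mem_codeEquivGroup σ (fun _ => D)).2 v
  have hlet : ∀ v, letterAt (monomial σ (fun _ => D) v) (Fin.last m) = D.act (letterAt v q) := by
    intro v
    rw [monomial_apply, letterAt_monomialMap, hσ, Equiv.symm_swap, Equiv.swap_apply_right]
  -- the transported code
  have hC' : IsAdditiveCode (g • S) 0 (d + 1) := (isAdditiveCode_smul_iff g S 0 (d + 1)).2 hC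
  obtain ⟨B, hB, hcount⟩ := exists_shortening_count hC' hd
  rw [hN B hB] at hcount
  rw [hcount]
  refine Finset.card_bij (fun v _ => monomial σ (fun _ => D) v) (fun v hv => ?_) (fun v _ v' _ h => ?_)
    (fun w hw => ?_)
  · rw [Finset.mem_filter, mem_codeWords] at hv ⊢
    obtain ⟨hvS, hvw, hvq⟩ := hv
    refine ⟨?_, by rw [hwt, hvw], ?_, ?_⟩
    · rw [mem_smul_iff]
      show (g : SympVec (m + 1) ≃ₗ[ZMod 2] SympVec (m + 1)).symm
          ((g : SympVec (m + 1) ≃ₗ[ZMod 2] SympVec (m + 1)) v) ∈ S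
      rw [LinearEquiv.symm_apply_apply]
      exact hvS
    · have := hlet v; rw [hvq, hD] at this; exact congrArg Prod.fst this
    · have := hlet v; rw [hvq, hD] at this; exact congrArg Prod.snd this
  · exact monomialMap_injective σ (fun _ => D) h
  · rw [Finset.mem_filter, mem_codeWords] at hw
    obtain ⟨hwS, hww, hw1, hw2⟩ := hw
    refine ⟨(g : SympVec (m + 1) ≃ₗ[ZMod 2] SympVec (m + 1)).symm w, ?_, ?_⟩
    · rw [Finset.mem_filter, mem_codeWords]
      refine ⟨(mem_smul_iff g S w).1 hwS, ?_, ?_⟩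
      · rw [← hww, ← hwt, ← hgv, LinearEquiv.apply_symm_apply]
      · apply D.act_injective
        rw [hD, ← hlet, ← hgv, LinearEquiv.apply_symm_apply]
        exact Prod.ext hw1 hw2
    · rw [← hgv, LinearEquiv.apply_symm_apply]

/-- **Hexacode**: in any `(6, 2⁶, 4)` code every (coordinate, nonzero letter) lies on exactly `10` words of weight `4`
(`45·4/6 = 30` per coordinate). Consequence drawn here from BGKW07 Rem. 2.7 + CRSS98 Thm. 6 (d); no printed statement located by the filer. [cite: CalderbankEtAl1998, §4 Thm. 6 (d) + `wtDist_5_0_3`] -/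
theorem card_minWeight_letter_6_0_4 {S : Submodule (ZMod 2) (SympVec 6)} (hC : IsAdditiveCode S 0 4) (q : Fin 6)
    {p : ZMod 2 × ZMod 2} (hp : p ≠ 0) : #{v ∈ codeWords S | sympWeight v = 4 ∧ letterAt v q = p} = 10 :=
  card_minWeight_letter_eq (m := 5) (d := 3) (by norm_num) (fun B hB => (wtDist_5_0_3 hB).1) hC q hp

/-- **Dodecacode**: in any `(12, 2¹², 6)` code every (coordinate, nonzero letter) lies on exactly `66` words of weight
`6` (`396·6/12 = 198` per coordinate). Consequence drawn here from BGKW07 Rem. 2.7 + CRSS98 Thm. 6 (d); no printed statement located by the filer. [cite: CalderbankEtAl1998, §4 Thm. 6 (d); BautistaEtAl2007, §6 (`wtDist_11_0_5`)] -/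
theorem card_minWeight_letter_12_0_6 {S : Submodule (ZMod 2) (SympVec 12)} (hC : IsAdditiveCode S 0 6) (q : Fin 12)
    {p : ZMod 2 × ZMod 2} (hp : p ≠ 0) : #{v ∈ codeWords S | sympWeight v = 6 ∧ letterAt v q = p} = 66 :=
  card_minWeight_letter_eq (m := 11) (d := 5) (by norm_num) (fun B hB => (wtDist_11_0_5 hB).1) hC q hp

/-- In any `(18, 2¹⁸, 8)` code every (coordinate, nonzero letter) lies on exactly `408` words of weight `8`. Consequence drawn here from BGKW07 Rem. 2.7 + CRSS98 Thm. 6 (d); no printed statement located by the filer.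
[cite: CalderbankEtAl1998, §4 Thm. 6 (d); BautistaEtAl2007, Rem. 2.7 (`wtDist_17_0_7`)] -/
theorem card_minWeight_letter_18_0_8 {S : Submodule (ZMod 2) (SympVec 18)} (hC : IsAdditiveCode S 0 8) (q : Fin 18)
    {p : ZMod 2 × ZMod 2} (hp : p ≠ 0) : #{v ∈ codeWords S | sympWeight v = 8 ∧ letterAt v q = p} = 408 :=
  card_minWeight_letter_eq (m := 17) (d := 7) (by norm_num) (fun B hB => (wtDist_17_0_7 hB).1) hC q hp

/-- ★ In a putative `(24, 2²⁴, 10)` additive code (HP03 Research Problem 9.10.7; CRSS Table III cell `(24,0)`) every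
(coordinate, nonzero letter) lies on exactly `2530` words of weight `10` — each coordinate on `7590` of the `18216`. Consequence drawn here from BGKW07 Rem. 2.7 + CRSS98 Thm. 6 (d); no printed statement located by the filer.
[cite: CalderbankEtAl1998, §4 Thm. 6 (d); BautistaEtAl2007, Rem. 2.7 (`wtDist_23_0_9`); HuffmanPless2003, §9.10 Research Problem 9.10.7] -/
theorem card_minWeight_letter_24_0_10 {S : Submodule (ZMod 2) (SympVec 24)} (hC : IsAdditiveCode S 0 10) (q : Fin 24)
    {p : ZMod 2 × ZMod 2} (hp : p ≠ 0) : #{v ∈ codeWords S | sympWeight v = 10 ∧ letterAt v q = p} = 2530 :=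
  card_minWeight_letter_eq (m := 23) (d := 9) (by norm_num) (fun B hB => (wtDist_23_0_9 hB).1) hC q hp

/-- In any `(30, 2³⁰, 12)` code every (coordinate, nonzero letter) lies on exactly `15834` words of weight `12`. Consequence drawn here from BGKW07 Rem. 2.7 + CRSS98 Thm. 6 (d); no printed statement located by the filer.
[cite: CalderbankEtAl1998, §4 Thm. 6 (d); BautistaEtAl2007, Rem. 2.7 (`wtDist_29_0_11`)] -/
theorem card_minWeight_letter_30_0_12 {S : Submodule (ZMod 2) (SympVec 30)} (hC : IsAdditiveCode S 0 12) (q : Fin 30)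
    {p : ZMod 2 × ZMod 2} (hp : p ≠ 0) : #{v ∈ codeWords S | sympWeight v = 12 ∧ letterAt v q = p} = 15834 :=
  card_minWeight_letter_eq (m := 29) (d := 11) (by norm_num) (fun B hB => (wtDist_29_0_11 hB).1) hC q hp

end Literature.InformationTheory.QuantumCodes
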